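import Summits.Ventures.PercRepro.C025ProfilePLDBridgeTruncate
import Summits.Ventures.PercRepro.C025ProfilePLDClosureArith

/-!
# PER-LAYER DOMINANCE IS PRESERVED BY PARALLEL EXTENSION: THE PROFILE OF A MATROID WITH A PARALLEL PAIR (night-3 g30)

`proofs/NIGHT3-G30-PAREXT.md` §1.  Let `e ∥ e'` be a parallel pair of a finite matroid `M` (both non-loops, each in the
closure of the other), `N := M ＼ {e'}` and `C := N ／ {e}`.  Every `I ⊆ E` is `I₀`, `I₀ + e`, `I₀ + e'` or `I₀ + e + e'`
for a unique `I₀ ⊆ E ∖ {e, e'}`, and the rank pairs are `(x₀, f₁)`, `(x₁, f₁)`, `(x₁, f₁)`, `(x₁, f₀)` with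
`x₀ = ρ(I₀)`, `x₁ = ρ(I₀ + e)`, `f₀ = ρ(E ∖ I₀ − e − e')`, `f₁ = ρ(E ∖ I₀ − e')` — a parallel element never changes a rank
once its mate is present.  The pairs `(x₀, f₁)` and `(x₁, f₀)` are the profile of `N` (`I₀` and `I₀ + e`), and `(x₁, f₁)`
is the profile of the contraction `C` shifted by `(1, 1)` (`ρ_C(X) + 1 = ρ_N(X + e)`).  So
  profile(M) = profile(N) + 2·shift₁₁(profile(C))                         (`sum_powerset_parallel`)
for EVERY function of the rank pair, and since PER-LAYER DOMINANCE is a cone condition preserved by the `(1,1)`-shift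
(`PLDClosure.shift11`, g29): (PLD)(N) ∧ (PLD)(C) ⟹ (PLD)(M) (`pld_of_parallel`) — in the hPLD binder of the landed bridge
`PLDBridge.rls_disjointSum_freeOn_of_pld` VERBATIM, hence C-025 at every `(p, q)` on every truncation of `M ⊕ free points`
(`rls_truncate_disjointSum_freeOn_of_parallel`).  The array-level statement needs no symmetry and no linear programme.
No `def`, no `instance`, no notation.  Axioms: standard.
-/

open scoped Matroid

namespace PercRepro

open Finset ThmH

namespace PLDParExt

variable {α : Type} [DecidableEq α]

omit [DecidableEq α] in
/-- The rank of a finite matroid is never `⊤`. -/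
theorem eRk_ne_top_of_finite (M : Matroid α) [M.Finite] (X : Set α) : M.eRk X ≠ ⊤ :=
  ne_top_of_le_ne_top (M.eRank_ne_top_iff.2 inferInstance) (M.eRk_le_eRank X)

omit [DecidableEq α] in
/-- Deleting `D` does not change the rank of a set disjoint from `D`. -/
theorem eRk_delete_of_subset (M : Matroid α) (D X : Set α) (h : X ⊆ M.E \ D) : (M ＼ D).eRk X = M.eRk X := by
  rw [Matroid.delete_eq_restrict, Matroid.restrict_eRk_eq M h]

omit [DecidableEq α] in
/-- Adding an element of the closure of `X` does not change the rank of `X`. -/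
theorem eRk_insert_of_mem_closure (M : Matroid α) {e : α} {X : Set α} (he : e ∈ M.closure X) :
    M.eRk (insert e X) = M.eRk X := by
  apply le_antisymm
  · calc M.eRk (insert e X) ≤ M.eRk (X ∪ M.closure X) :=
          M.eRk_mono (Set.insert_subset (Set.mem_union_right _ he) Set.subset_union_left)
      _ = M.eRk (X ∪ X) := M.eRk_union_closure_right_eq X X
      _ = M.eRk X := by rw [Set.union_self]
  · exact M.eRk_mono (Set.subset_insert e X)

omit [DecidableEq α] in
/-- THE RANK OF A CONTRACTION BY A NON-LOOP: `ρ_{M/e}(X) + 1 = ρ_M(X + e)` (any `X`: `e` is not in the ground set of `M / e`). -/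
theorem eRk_contract_singleton_add_one (M : Matroid α) {e : α} (he : M.IsNonloop e) (X : Set α) :
    (M ／ {e}).eRk X + 1 = M.eRk (insert e X) := by
  obtain ⟨J, hJ, heJ⟩ := he.indep.subset_isBasis'_of_subset (Set.singleton_subset_iff.2 (Set.mem_insert e X))
  have h2 := hJ.contract_isBasis'_sdiff_of_subset heJ
  have h3 : (M ／ {e}).eRk (insert e X) = (M ／ {e}).eRk X := by
    apply Matroid.eRk_insert_of_notMem_ground
    rw [Matroid.contract_ground]
    exact fun h => h.2 rfl
  rw [← h3, ← h2.encard_eq_eRk, ← hJ.encard_eq_eRk,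
    Set.encard_sdiff_singleton_add_one (Set.singleton_subset_iff.1 heJ)]

omit [DecidableEq α] in
/-- The `ℕ`-valued form of `eRk_contract_singleton_add_one` for a finite matroid. -/
theorem toNat_eRk_contract_singleton_add_one (M : Matroid α) [M.Finite] {e : α} (he : M.IsNonloop e) (X : Set α) :
    ((M ／ {e}).eRk X).toNat + 1 = (M.eRk (insert e X)).toNat := by
  have h := eRk_contract_singleton_add_one M he X
  haveI : (M ／ {e}).Finite := Matroid.contract_finite
  obtain ⟨a, ha⟩ : ∃ a : ℕ, (M ／ {e}).eRk X = a := ⟨_, (ENat.coe_toNat (eRk_ne_top_of_finite _ X)).symm⟩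
  rw [ha] at h ⊢
  rw [← h, ← Nat.cast_add_one, ENat.toNat_coe, ENat.toNat_coe]

/-- The ground finset of `M ＼ {e'}`. -/
theorem gr_delete_singleton (M : Matroid α) [M.Finite] (e' : α) : gr (M ＼ {e'}) = (gr M).erase e' := by
  apply Finset.coe_injective
  rw [coe_gr, Matroid.delete_ground, coe_erase, coe_gr]

/-- The ground finset of `(M ＼ {e'}) ／ {e}`. -/
theorem gr_delete_contract (M : Matroid α) [M.Finite] (e e' : α) :
    gr ((M ＼ {e'}) ／ {e}) = ((gr M).erase e').erase e := by
  apply Finset.coe_injective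
  rw [coe_gr, Matroid.contract_ground, Matroid.delete_ground, coe_erase, coe_erase, coe_gr]

omit [DecidableEq α] in
/-- For a parallel pair `e ∥ e'`, adding `e'` to a set is the same as adding `e`, rank-wise. -/
theorem eRk_insert_parallel (M : Matroid α) {e e' : α} (hcl : e' ∈ M.closure {e}) (hcl' : e ∈ M.closure {e'})
    (S : Set α) : M.eRk (insert e' S) = M.eRk (insert e S) := by
  have h1 : e ∈ M.closure (insert e' S) :=
    M.closure_mono (Set.singleton_subset_iff.2 (Set.mem_insert e' S)) hcl'
  have h2 : e' ∈ M.closure (insert e S) :=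
    M.closure_mono (Set.singleton_subset_iff.2 (Set.mem_insert e S)) hcl
  rw [← eRk_insert_of_mem_closure M h1, Set.insert_comm, eRk_insert_of_mem_closure M h2]

omit [DecidableEq α] in
/-- For a parallel pair `e ∥ e'`, adding `e'` to a set containing `e` does not change the rank. -/
theorem eRk_insert_insert_parallel (M : Matroid α) {e e' : α} (hcl : e' ∈ M.closure {e}) (S : Set α) :
    M.eRk (insert e' (insert e S)) = M.eRk (insert e S) :=
  eRk_insert_of_mem_closure M (M.closure_mono (Set.singleton_subset_iff.2 (Set.mem_insert e S)) hcl)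

/-- THE PROFILE OF A MATROID WITH A PARALLEL PAIR `e ∥ e'`: for every function `F` of the rank pair,
`Σ_{I ⊆ E} F(ρI, ρ(E∖I)) = Σ_{J ⊆ E−e'} F(ρ_N J, ρ_N(E−e'−J)) + 2·Σ_{I₀ ⊆ E−e−e'} F(ρ_C I₀ + 1, ρ_C(E−e−e'−I₀) + 1)`
with `N = M ＼ {e'}` and `C = N ／ {e}`: the profile of `M` is the profile of `N` plus twice the `(1,1)`-shift of the
profile of `C`. -/
theorem sum_powerset_parallel (M : Matroid α) [M.Finite] {e e' : α} (hne : e ≠ e') (he : M.IsNonloop e)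
    (he' : M.IsNonloop e') (hcl : e' ∈ M.closure {e}) (hcl' : e ∈ M.closure {e'}) (F : ℕ → ℕ → ℕ) :
    ∑ I ∈ (gr M).powerset, F (M.eRk (I : Set α)).toNat (M.eRk ((gr M \ I : Finset α) : Set α)).toNat =
      ∑ J ∈ (gr (M ＼ {e'})).powerset,
          F ((M ＼ {e'}).eRk (J : Set α)).toNat ((M ＼ {e'}).eRk ((gr (M ＼ {e'}) \ J : Finset α) : Set α)).toNat +
        2 * ∑ I₀ ∈ (gr ((M ＼ {e'}) ／ {e})).powerset,
          F ((((M ＼ {e'}) ／ {e}).eRk (I₀ : Set α)).toNat + 1)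
            ((((M ＼ {e'}) ／ {e}).eRk ((gr ((M ＼ {e'}) ／ {e}) \ I₀ : Finset α) : Set α)).toNat + 1) := by
  -- the three ground finsets
  set K : Finset α := ((gr M).erase e').erase e with hK
  have heM : e ∈ gr M := by rw [← Finset.mem_coe, coe_gr]; exact he.mem_ground
  have he'M : e' ∈ gr M := by rw [← Finset.mem_coe, coe_gr]; exact he'.mem_ground
  have heK : e ∉ K := Finset.notMem_erase e _
  have he'K : e' ∉ K := fun h => Finset.notMem_erase e' _ (Finset.mem_of_mem_erase h)
  have he'eK : e' ∉ insert e K := by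
    rw [Finset.mem_insert, not_or]; exact ⟨hne.symm, he'K⟩
  have hgrN : gr (M ＼ {e'}) = insert e K := by
    rw [gr_delete_singleton, hK, Finset.insert_erase (Finset.mem_erase.2 ⟨hne, heM⟩)]
  have hgrC : gr ((M ＼ {e'}) ／ {e}) = K := gr_delete_contract M e e'
  have hgrM : gr M = insert e' (insert e K) := by
    rw [hK, Finset.insert_erase (Finset.mem_erase.2 ⟨hne, heM⟩), Finset.insert_erase he'M]
  have hNe : (M ＼ {e'}).IsNonloop e := Matroid.delete_isNonloop_iff.2 ⟨he, by simpa using hne⟩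
  have hKE : (K : Set α) ⊆ M.E \ {e'} := by
    intro x hx
    rw [Finset.mem_coe, hK, Finset.mem_erase, Finset.mem_erase, ← Finset.mem_coe, coe_gr] at hx
    exact ⟨hx.2.2, hx.2.1⟩
  rw [hgrM, hgrN, hgrC, Finset.sum_powerset_insert he'eK, Finset.sum_powerset_insert heK,
    Finset.sum_powerset_insert heK, Finset.sum_powerset_insert heK, Finset.mul_sum]
  simp only [← Finset.sum_add_distrib]
  refine Finset.sum_congr rfl fun I₀ hI₀ => ?_
  have hIK : I₀ ⊆ K := Finset.mem_powerset.1 hI₀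
  have heI : e ∉ I₀ := fun h => heK (hIK h)
  have he'I : e' ∉ I₀ := fun h => he'K (hIK h)
  have he'eI : e' ∉ insert e I₀ := by
    rw [Finset.mem_insert, not_or]; exact ⟨hne.symm, he'I⟩
  have heKI : e ∉ K \ I₀ := fun h => heK (Finset.mem_sdiff.1 h).1
  -- the complements
  have c1 : insert e' (insert e K) \ I₀ = insert e' (insert e (K \ I₀)) := by
    rw [Finset.insert_sdiff_of_notMem _ he'I, Finset.insert_sdiff_of_notMem _ heI]
  have c2 : insert e' (insert e K) \ insert e I₀ = insert e' (K \ I₀) := by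
    rw [Finset.insert_sdiff_of_notMem _ he'eI, Finset.insert_sdiff_insert, Finset.sdiff_insert,
      Finset.erase_eq_of_notMem heKI]
  have c3 : insert e' (insert e K) \ insert e' I₀ = insert e (K \ I₀) := by
    rw [Finset.insert_sdiff_insert, Finset.sdiff_insert, Finset.insert_sdiff_of_notMem _ heI,
      Finset.erase_insert_of_ne hne, Finset.erase_eq_of_notMem (fun h => he'K (Finset.mem_sdiff.1 h).1)]
  have c4 : insert e' (insert e K) \ insert e' (insert e I₀) = K \ I₀ := by
    rw [Finset.insert_sdiff_insert, Finset.sdiff_insert, Finset.insert_sdiff_insert, Finset.sdiff_insert,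
      Finset.erase_eq_of_notMem heKI, Finset.erase_eq_of_notMem (fun h => he'K (Finset.mem_sdiff.1 h).1)]
  have c5 : insert e K \ I₀ = insert e (K \ I₀) := Finset.insert_sdiff_of_notMem _ heI
  have c6 : insert e K \ insert e I₀ = K \ I₀ := by
    rw [Finset.insert_sdiff_insert, Finset.sdiff_insert, Finset.erase_eq_of_notMem heKI]
  rw [c1, c2, c3, c4, c5, c6]
  simp only [Finset.coe_insert]
  -- the ranks: `e'` never changes a rank once `e` is present
  have hIE : (I₀ : Set α) ⊆ M.E \ {e'} := fun x hx => hKE (hIK hx)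
  have hKIE : ((K \ I₀ : Finset α) : Set α) ⊆ M.E \ {e'} := fun x hx => hKE (Finset.mem_sdiff.1 hx).1
  have heE : insert e (I₀ : Set α) ⊆ M.E \ {e'} :=
    Set.insert_subset ⟨he.mem_ground, by simpa using hne⟩ hIE
  have heKE : insert e ((K \ I₀ : Finset α) : Set α) ⊆ M.E \ {e'} :=
    Set.insert_subset ⟨he.mem_ground, by simpa using hne⟩ hKIE
  rw [eRk_insert_parallel M hcl hcl' (I₀ : Set α), eRk_insert_insert_parallel M hcl (I₀ : Set α),
    eRk_insert_parallel M hcl hcl' ((K \ I₀ : Finset α) : Set α),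
    eRk_insert_insert_parallel M hcl ((K \ I₀ : Finset α) : Set α),
    eRk_delete_of_subset M {e'} _ hIE, eRk_delete_of_subset M {e'} _ heE, eRk_delete_of_subset M {e'} _ hKIE,
    eRk_delete_of_subset M {e'} _ heKE, toNat_eRk_contract_singleton_add_one (M ＼ {e'}) hNe,
    toNat_eRk_contract_singleton_add_one (M ＼ {e'}) hNe, eRk_delete_of_subset M {e'} _ heE,
    eRk_delete_of_subset M {e'} _ heKE]
  ring

/-- PER-LAYER DOMINANCE IS PRESERVED BY PARALLEL EXTENSION: if `e ∥ e'` is a parallel pair of the finite matroid `M` and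
both `M ＼ {e'}` and `(M ＼ {e'}) ／ {e}` satisfy the hPLD binder of `PLDBridge.rls_disjointSum_freeOn_of_pld`, so does
`M`. -/
theorem pld_of_parallel (M : Matroid α) [M.Finite] {e e' : α} (hne : e ≠ e') (he : M.IsNonloop e)
    (he' : M.IsNonloop e') (hcl : e' ∈ M.closure {e}) (hcl' : e ∈ M.closure {e'})
    (hN : ∀ lo hi δ Θ : ℕ, Θ ≤ lo + hi + δ → (lo = 0 ∨ lo + hi + δ ≤ Θ) →
      (∑ I ∈ (gr (M ＼ {e'})).powerset, (if lo ≤ ((M ＼ {e'}).eRk (I : Set α)).toNat ∧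
          ((M ＼ {e'}).eRk (I : Set α)).toNat ≤ hi ∧
          Θ ≤ ((M ＼ {e'}).eRk ((gr (M ＼ {e'}) \ I : Finset α) : Set α)).toNat +
            ((M ＼ {e'}).eRk (I : Set α)).toNat then
          (((M ＼ {e'}).eRk ((gr (M ＼ {e'}) \ I : Finset α) : Set α)).toNat).choose δ else 0)) ≤
        ∑ I ∈ (gr (M ＼ {e'})).powerset, (if lo + δ ≤ ((M ＼ {e'}).eRk ((gr (M ＼ {e'}) \ I : Finset α) : Set α)).toNat ∧
          ((M ＼ {e'}).eRk ((gr (M ＼ {e'}) \ I : Finset α) : Set α)).toNat ≤ hi + δ then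
          (((M ＼ {e'}).eRk ((gr (M ＼ {e'}) \ I : Finset α) : Set α)).toNat).choose δ else 0))
    (hC : ∀ lo hi δ Θ : ℕ, Θ ≤ lo + hi + δ → (lo = 0 ∨ lo + hi + δ ≤ Θ) →
      (∑ I ∈ (gr ((M ＼ {e'}) ／ {e})).powerset, (if lo ≤ (((M ＼ {e'}) ／ {e}).eRk (I : Set α)).toNat ∧
          (((M ＼ {e'}) ／ {e}).eRk (I : Set α)).toNat ≤ hi ∧
          Θ ≤ (((M ＼ {e'}) ／ {e}).eRk ((gr ((M ＼ {e'}) ／ {e}) \ I : Finset α) : Set α)).toNat +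
            (((M ＼ {e'}) ／ {e}).eRk (I : Set α)).toNat then
          ((((M ＼ {e'}) ／ {e}).eRk ((gr ((M ＼ {e'}) ／ {e}) \ I : Finset α) : Set α)).toNat).choose δ else 0)) ≤
        ∑ I ∈ (gr ((M ＼ {e'}) ／ {e})).powerset,
          (if lo + δ ≤ (((M ＼ {e'}) ／ {e}).eRk ((gr ((M ＼ {e'}) ／ {e}) \ I : Finset α) : Set α)).toNat ∧
          (((M ＼ {e'}) ／ {e}).eRk ((gr ((M ＼ {e'}) ／ {e}) \ I : Finset α) : Set α)).toNat ≤ hi + δ then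
          ((((M ＼ {e'}) ／ {e}).eRk ((gr ((M ＼ {e'}) ／ {e}) \ I : Finset α) : Set α)).toNat).choose δ else 0)) :
    ∀ lo hi δ Θ : ℕ, Θ ≤ lo + hi + δ → (lo = 0 ∨ lo + hi + δ ≤ Θ) →
      (∑ I ∈ (gr M).powerset, (if lo ≤ (M.eRk (I : Set α)).toNat ∧ (M.eRk (I : Set α)).toNat ≤ hi ∧
          Θ ≤ (M.eRk ((gr M \ I : Finset α) : Set α)).toNat + (M.eRk (I : Set α)).toNat then
          ((M.eRk ((gr M \ I : Finset α) : Set α)).toNat).choose δ else 0)) ≤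
        ∑ I ∈ (gr M).powerset, (if lo + δ ≤ (M.eRk ((gr M \ I : Finset α) : Set α)).toNat ∧
          (M.eRk ((gr M \ I : Finset α) : Set α)).toNat ≤ hi + δ then
          ((M.eRk ((gr M \ I : Finset α) : Set α)).toNat).choose δ else 0) := by
  intro lo hi δ Θ hΘ hlo
  have hL := sum_powerset_parallel M hne he he' hcl hcl'
    (fun x f => if lo ≤ x ∧ x ≤ hi ∧ Θ ≤ f + x then f.choose δ else 0)
  have hR := sum_powerset_parallel M hne he he' hcl hcl'
    (fun x f => if lo + δ ≤ f ∧ f ≤ hi + δ then f.choose δ else 0)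
  beta_reduce at hL hR
  rw [hL, hR]
  have h1 := hN lo hi δ Θ hΘ hlo
  have h2 := PLDClosure.shift11 (gr ((M ＼ {e'}) ／ {e})).powerset
    (fun I => (((M ＼ {e'}) ／ {e}).eRk (I : Set α)).toNat)
    (fun I => (((M ＼ {e'}) ／ {e}).eRk ((gr ((M ＼ {e'}) ／ {e}) \ I : Finset α) : Set α)).toNat) hC lo hi δ Θ hΘ hlo
  beta_reduce at h2
  omega

/-- C-025 AT EVERY `(p, q)` ON EVERY TRUNCATION OF «M ⊕ FREE POINTS» for a finite matroid `M` with a parallel pair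
`e ∥ e'` whose deletion `M ＼ {e'}` and deletion-contraction `(M ＼ {e'}) ／ {e}` satisfy PER-LAYER DOMINANCE. -/
theorem rls_truncate_disjointSum_freeOn_of_parallel (M : Matroid α) [M.Finite] {e e' : α} (hne : e ≠ e')
    (he : M.IsNonloop e) (he' : M.IsNonloop e') (hcl : e' ∈ M.closure {e}) (hcl' : e ∈ M.closure {e'})
    (hN : ∀ lo hi δ Θ : ℕ, Θ ≤ lo + hi + δ → (lo = 0 ∨ lo + hi + δ ≤ Θ) →
      (∑ I ∈ (gr (M ＼ {e'})).powerset, (if lo ≤ ((M ＼ {e'}).eRk (I : Set α)).toNat ∧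
          ((M ＼ {e'}).eRk (I : Set α)).toNat ≤ hi ∧
          Θ ≤ ((M ＼ {e'}).eRk ((gr (M ＼ {e'}) \ I : Finset α) : Set α)).toNat +
            ((M ＼ {e'}).eRk (I : Set α)).toNat then
          (((M ＼ {e'}).eRk ((gr (M ＼ {e'}) \ I : Finset α) : Set α)).toNat).choose δ else 0)) ≤
        ∑ I ∈ (gr (M ＼ {e'})).powerset, (if lo + δ ≤ ((M ＼ {e'}).eRk ((gr (M ＼ {e'}) \ I : Finset α) : Set α)).toNat ∧
          ((M ＼ {e'}).eRk ((gr (M ＼ {e'}) \ I : Finset α) : Set α)).toNat ≤ hi + δ then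
          (((M ＼ {e'}).eRk ((gr (M ＼ {e'}) \ I : Finset α) : Set α)).toNat).choose δ else 0))
    (hC : ∀ lo hi δ Θ : ℕ, Θ ≤ lo + hi + δ → (lo = 0 ∨ lo + hi + δ ≤ Θ) →
      (∑ I ∈ (gr ((M ＼ {e'}) ／ {e})).powerset, (if lo ≤ (((M ＼ {e'}) ／ {e}).eRk (I : Set α)).toNat ∧
          (((M ＼ {e'}) ／ {e}).eRk (I : Set α)).toNat ≤ hi ∧
          Θ ≤ (((M ＼ {e'}) ／ {e}).eRk ((gr ((M ＼ {e'}) ／ {e}) \ I : Finset α) : Set α)).toNat +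
            (((M ＼ {e'}) ／ {e}).eRk (I : Set α)).toNat then
          ((((M ＼ {e'}) ／ {e}).eRk ((gr ((M ＼ {e'}) ／ {e}) \ I : Finset α) : Set α)).toNat).choose δ else 0)) ≤
        ∑ I ∈ (gr ((M ＼ {e'}) ／ {e})).powerset,
          (if lo + δ ≤ (((M ＼ {e'}) ／ {e}).eRk ((gr ((M ＼ {e'}) ／ {e}) \ I : Finset α) : Set α)).toNat ∧
          (((M ＼ {e'}) ／ {e}).eRk ((gr ((M ＼ {e'}) ／ {e}) \ I : Finset α) : Set α)).toNat ≤ hi + δ then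
          ((((M ＼ {e'}) ／ {e}).eRk ((gr ((M ＼ {e'}) ／ {e}) \ I : Finset α) : Set α)).toNat).choose δ else 0))
    (E₃ : Finset α) (h₃ : Disjoint M.E (E₃ : Set α)) (r p q : ℕ) :
    haveI := PLDBridge.disjointSum_freeOn_finite M E₃ h₃
    ThmN.RLS (PercRepro.Matroid.truncate (M.disjointSum (Matroid.freeOn (E₃ : Set α)) h₃) r) p q :=
  PLDBridge.rls_disjointSum_freeOn_of_pld M E₃ h₃ r p q (pld_of_parallel M hne he he' hcl hcl' hN hC)

end PLDParExt

end PercRepro
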